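import Summits.QuantumFields.BalabanUV.Beta.BorderJetWardFluct
import Summits.QuantumFields.BalabanUV.Beta.BorderWardSiteLaw
import Summits.QuantumFields.BalabanUV.Beta.RootedMixedJetLinear

/-!
# `BalabanUV.Beta.BorderWardSiteLawFluct` — binder row D1, «GAUGE-LETTERS» (G4-B′): **THE SITE LAW OF NODE 12b's BORDER TABLE `vh2Tab` IN ITS FIRST
# (FLUCTUATION) SLOT, AT EVERY SITE — the `(0,3)`-entries of G3′ `BorderJetWardFluct.T2At_gauge_fluct` at matrix-unit letters**
# (β sub-cell; D1 formalisation swarm LEAF PROVER 02, road «FP» ROUTE T, (COV-m) order 2 — the per-site letter behind the door's `c2`)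

HONEST FRAMING (cell charter, verbatim): «discharging BetaPertH makes Balaban's UV stability UNCONDITIONAL — a real
constructive-QFT result; it is NOT the continuum limit and NOT the Clay problem.»
HONEST DEPENDENCY: continuum YM on T⁴ ⇐ BetaPertH ∧ nine spine estimates (0/9 proved); BetaPertH ⇐ (D1) ∧ (D4) ∧ CAP+tail;
G-an2-4 gates asym, D1 and NE2/3/4.
DERIVED cell leaf ([folklore] letter algebra and `4 × 4` word evaluation), BY NAME over G3′ `BorderJetWardFluct` (`T2At_gauge_fluct`, `fst_PhiLAt_zero_mul_fst_invT`),
node 12 ∕ 12b (`T2At`, `vh2Tab`, `UT`, `E`, `Yf ∕ Yb`, `wU`, `gmode2o`), node 10 `AveragingGaugeModes.gmode1_single`, node 7aρ (`vhUAt_single`, `hessUAt_single`,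
`linAvgAt_single`, `bw_single`, `hessCountAt_swap`), G4-B `BorderWardSiteLaw.ent_B2`, G4-M `MixedWardSiteLaw.ent_W4_ap`,
`RootedMixedJetLinear.upF_add`, 33M3a `RootedJetDictionary` (`PhiGAt_add_top`, `c11_logT_PhiGAt_Y`, `c00_PhiGAt`, `inv_smul_sum_box_loopCAt`),
33J `RootedT2JetDictionary` (`c10 ∕ c01_PhiGAt_Y`, `c11_eq_logT_add`), `RootedJetLinear` (`T2At_add_ω ∕ _neg_ω`), 33K `RootedMixedTableLaw` (`ent_X2_ap`,
`ent_Xc_ap`, `ite_entry`).  No statement of Bałaban's papers, no `[cite:]`, no `def`, no `Prop` fact; the fluctuation-slot twin of G4-B `BorderWardSiteLaw`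
(`vh2Tab_siteWard₁∕₂` = the two BACKGROUND slots).  Discharges NO binder; 0∕4.  NOT D1, NOT `BetaPertH`, NOT continuum, NOT Clay.  «not in print; our bookkeeping».

WHAT (`r = L·y + ρ`, `r₊ = r + L·e_μ`, `ℓ = L^d`; `n = linCountAt`, `hess = hessCountAt`, `m = vhCountAt` — node 7aρ's rooted UNNORMALISED counts; `s = vh2Tab`):
* §1 letters: `grad_ite_eq_sum` (`∇(δ_u v) = Σ_κ (single (κ, u − e_κ) v − single (κ, u) v)`), `upF_sub' ∕ upF_sum'`, `T2At_sub_ω ∕ T2At_sum_ω`, and the gauge modes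
  of single letters against a site letter: `gmode1_single_eq`, `gmode2o_single_single`.
* §2 the `(0,3)` entries of the words that occur (`ent_R1 … ent_R7r`; G4-B's `ent_B2`, G4-M's `ent_W4_ap`, 33K's entries BY NAME).
* §3 THE ROOT TERM, generic `𝔸`: `fst_PhiRAt_zero` (`Φ₀ := (PhiRAt ρ 0 B B′).fst = PhiGAt (Ebg B B′) (Ebi B B′)`), `Ebg_eq_Yf ∕ Ebi_eq_Yb` (`E = Y(B′;B) + τ₁τ₂[B,B′]`),
  `fst_PhiRAt_zero_eq_Y` (33M3a `PhiGAt_add_top`), the components **`c10 ∕ c01 ∕ c11_fst_PhiRAt_zero`** (`ℓ⁻¹•Z_B`, `ℓ⁻¹•Z_{B′}`, and the pure-background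
  ordered-pair functional `(2ℓ)⁻¹•(hessUAt ρ B′ B + Z_{[B′,B]}) + ℓ⁻¹•Z_{[B,B′]} + (2ℓ²)⁻¹•{Z_B, Z_{B′}}`), and the CONJUGATION FORMULA **`c11_conj_ι`**:
  `X·P = 1, c00 X = 1 ⇒ c11 (X·ιD·P) = sD − Ds + D(pq + qp) − pDq − qDp` (`X = 1 + τ₁p + τ₂q + τ₁τ₂s`).
* §4 at `𝔸 = UT`, `λ = δ_u E₂₃` (fluctuation unit), `B = single g E₀₁`, `B′ = single h E₁₂`: the two root entries `root_entry_gh ∕ root_entry_hg` and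
  **`vh2Tab_siteWard₀`**: `Σ_κ (s((κ, u − e_κ); g, h) − s((κ, u); g, h)) = ℓ⁻²·[u = h₊]·m(h, g) − ℓ⁻¹·[g = h]·[u = g₊]·n(g) + [u = r₊]·(ℓ⁻¹·hess(g, h) + ℓ⁻²·n(g)·n(h))`
  — the second background rotated at its far end and paired with the first by the first-order border count WITH THE SLOTS EXCHANGED (`h` in the fluctuation
  slot), the diagonal double rotation read by the linear count, and the ROOT contact at the far end of the coarse bond (the pure-background ordered-pair count —
  the two orders' `[g = h]` pieces cancel, `hessCountAt_swap` folds the two `hess` terms).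
READING toward the door (bookkeeping, not proved here): in the door's letters this is `Q₁₂^{(g,h)}·D = −Q₁₁^{(g)}(·, h)[tip h] + [g = h]·c·Q₁₀(·, g)[tip g] + Far`
— the shape Q-d1leaf02-g23-1 printed and an2 W-an2-g43-10 confirmed, with the root weight `ℓ⁻¹·hess(g,h) + ℓ⁻²·n_g·n_h` now EXPLICIT (C2-DET (r2)'s
`κ`-fit predicts from it); the symmetrisation over `(g, h)` of the record's `symVh₂SAn1` supplies the mirrored tip term.
NOT HERE: the (0.4)-symmetrised twin (`symVh2Tab`, over `symPhiGAt`), the packed kernels (`vh₂SAt ∕ symVh₂SAt ∕ symVh₂SAn1`), the torus face (`c2`).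
Provenance: D1 formalisation swarm LEAF PROVER 02, unit b2b-balaban-beta-d1-formalise-leaf-02 gen 23, 2026-08-22∕23; no existing file touched.
-/

namespace Summit.QuantumFields.BalabanUV.Beta.BorderWardSiteLawFluct

open Finset
open scoped BigOperators
open Literature.MathematicalPhysics.QuantumFieldTheory.Balaban1983to89
open Literature.MathematicalPhysics.QuantumFieldTheory.Balaban1983to89.Beta
open AffineAveraging (Form1 Site unitVec)
open AveragingContours (grad segUp)
open AveragingContoursRooted (linAvgAt loopCAt)
open AveragingGaugeModes (gmode1 gmode1_apply)
open AveragingHessianKernels (Bond single single_apply bw bw_single)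
open AveragingHessianKernelsRooted (vhUAt vhCountAt hessUAt hessCountAt linCountAt vhUAt_single hessUAt_single linAvgAt_single hessCountAt_swap)
open AveragingThirdJet (Tau Rho dmk fst_dmk snd_dmk dfst_mul dsnd_mul upF upF_apply Ebg Ebi logT invT Yf Yb wU gmode2o)
open AveragingThirdJet.Tau (τ₁ τ₂ τ12 ι c00 c10 c01 c11 mk ext4)
open AveragingMixedJetTables (PhiGAt map_PhiGAt QjetAt T2At PhiRAt T2At_ω_zero UT E vh2Tab)
open Summit.QuantumFields.BalabanUV.Beta.RootedJetReflection (PhiLAt GfL GbL fst_GfL fst_GbL PhiRAt_eq_PhiLAt)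
open Summit.QuantumFields.BalabanUV.Beta.RootedJetLinear (T2At_add_ω T2At_neg_ω)
open Summit.QuantumFields.BalabanUV.Beta.RootedJetDictionary (inv_smul_sum_box_loopCAt c11_logT_PhiGAt_Y c00_PhiGAt PhiGAt_add_top)
open Summit.QuantumFields.BalabanUV.Beta.RootedT2JetDictionary (c10_PhiGAt_Y c01_PhiGAt_Y c11_eq_logT_add)
open Summit.QuantumFields.BalabanUV.Beta.RootedMixedTableLaw (ent_X2_ap ent_Xc_ap ite_entry)
open Summit.QuantumFields.BalabanUV.Beta.MixedWardSiteLaw (ent_W4_ap)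
open Summit.QuantumFields.BalabanUV.Beta.BorderWardSiteLaw (ent_B2)
open Summit.QuantumFields.BalabanUV.Beta.RootedMixedJetLinear (upF_add)
open Summit.QuantumFields.BalabanUV.Beta.BorderJetWardFluct (fst_PhiLAt_zero_mul_fst_invT T2At_gauge_fluct)

variable {𝕜 : Type*} [Field 𝕜] {d : ℕ} {𝔸 : Type*} [Ring 𝔸] [Algebra 𝕜 𝔸]

/-! ## §1 Letters: the gradient of a site letter, additivity of `T2At` in the fluctuation, gauge modes of single letters -/

section Letters

omit [Algebra 𝕜 𝔸] in
/-- [folklore] The gradient of the `𝔸`-valued site letter `δ_u v` in bond letters: `∇(δ_u v) = Σ_κ (single (κ, u − e_κ) v − single (κ, u) v)`. -/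
theorem grad_ite_eq_sum (u : Site d) (v : 𝔸) :
    grad (fun x' : Site d => if x' = u then v else 0) = ∑ κ : Fin d, (single (κ, u - unitVec κ) v - single (κ, u) v) := by
  funext κ x
  simp only [grad, Finset.sum_apply, Pi.sub_apply, single_apply, Prod.mk.injEq, ite_and, Finset.sum_sub_distrib, Finset.sum_ite_eq,
    Finset.mem_univ, if_true]
  have e1 : (x = u - unitVec κ) ↔ (x + unitVec κ = u) := by rw [eq_sub_iff_add_eq]
  simp only [e1]

omit [Algebra 𝕜 𝔸] in
/-- [folklore] `upF` commutes with subtraction. -/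
theorem upF_sub' (W W' : Form1 d 𝔸) : upF (W - W') = upF W - upF W' := by
  funext κ x; exact ext4 (by simp) (by simp) (by simp) (by simp)

omit [Algebra 𝕜 𝔸] in
/-- [folklore] `upF` commutes with finite sums. -/
theorem upF_sum' {ι' : Type*} (s : Finset ι') (W : ι' → Form1 d 𝔸) : upF (∑ i ∈ s, W i) = ∑ i ∈ s, upF (W i) := by
  classical
  induction s using Finset.induction_on with
  | empty => funext κ x; exact ext4 (by simp) (by simp) (by simp) (by simp)
  | insert a s ha ih => rw [Finset.sum_insert ha, Finset.sum_insert ha, upF_add, ih]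

/-- [folklore] `T2At ρ` commutes with subtraction in the fluctuation. -/
theorem T2At_sub_ω (ρ : Fin d → ℤ) (ω₁ ω₂ : Form1 d (Tau 𝔸)) (B B' : Form1 d 𝔸) (L : ℕ) (μ : Fin d) (y : Fin d → ℤ) :
    T2At 𝕜 ρ (ω₁ - ω₂) B B' L μ y = T2At 𝕜 ρ ω₁ B B' L μ y - T2At 𝕜 ρ ω₂ B B' L μ y := by
  rw [sub_eq_add_neg, T2At_add_ω, T2At_neg_ω, ← sub_eq_add_neg]

/-- [folklore] `T2At ρ` commutes with finite sums in the fluctuation. -/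
theorem T2At_sum_ω {ι' : Type*} (s : Finset ι') (ω : ι' → Form1 d (Tau 𝔸)) (ρ : Fin d → ℤ) (B B' : Form1 d 𝔸) (L : ℕ) (μ : Fin d)
    (y : Fin d → ℤ) : T2At 𝕜 ρ (∑ i ∈ s, ω i) B B' L μ y = ∑ i ∈ s, T2At 𝕜 ρ (ω i) B B' L μ y := by
  classical
  induction s using Finset.induction_on with
  | empty => rw [Finset.sum_empty, Finset.sum_empty, T2At_ω_zero]
  | insert a s ha ih => rw [Finset.sum_insert ha, Finset.sum_insert ha, T2At_add_ω, ih]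

omit [Algebra 𝕜 𝔸] in
/-- [folklore] The first gauge mode of a single background letter against a site letter is a single letter at the same bond:
`[single f w, (δ_u v)₊] = single f ([f₊ = u]·[w, v])`. -/
theorem gmode1_single_eq (f : Bond d) (w : 𝔸) (u : Site d) (v : 𝔸) :
    gmode1 (single f w) (fun x' : Site d => if x' = u then v else 0) = single f (if f.2 + unitVec f.1 = u then AveragingHessianKernels.comm w v else 0) := by
  funext κ x
  rw [AveragingGaugeModes.gmode1_single, single_apply]
  by_cases h : (κ, x) = f
  · subst h; simp
  · simp [h]

omit [Algebra 𝕜 𝔸] in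
/-- [folklore] The ordered double gauge mode of two single background letters: `[single g a, [single h b, (δ_u v)₊]] = single g ([g = h]·[g₊ = u]·[a, [b, v]])`. -/
theorem gmode2o_single_single (g h : Bond d) (a b : 𝔸) (u : Site d) (v : 𝔸) :
    gmode2o (single g a) (single h b) (fun x' : Site d => if x' = u then v else 0)
      = single g (if g = h ∧ g.2 + unitVec g.1 = u then AveragingHessianKernels.comm a (AveragingHessianKernels.comm b v) else 0) := by
  funext κ x
  simp only [gmode2o, single_apply]
  by_cases hg : (κ, x) = g
  · subst hg
    by_cases hh : (κ, x) = h
    · subst hh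
      by_cases hu : x + unitVec κ = u
      · simp [hu]
      · simp [hu, AveragingHessianKernels.comm]
    · simp [hh, AveragingHessianKernels.comm]
  · simp [hg, AveragingHessianKernels.comm]

end Letters

/-! ## §2 Entries of the `4 × 4` words -/

section Entries

/-- [folklore] `([E₁₂, E₀₁]·E₂₃)₀₃ = −1`. -/
theorem ent_R1 : (AveragingHessianKernels.comm (E 1 2) (E 0 1) * E 2 3) 0 3 = -1 := by simp [AveragingHessianKernels.comm, E]
/-- [folklore] `([E₀₁, E₁₂]·E₂₃)₀₃ = 1`. -/
theorem ent_R2 : (AveragingHessianKernels.comm (E 0 1) (E 1 2) * E 2 3) 0 3 = 1 := by simp [AveragingHessianKernels.comm, E]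
/-- [folklore] `(E₂₃·X)₀₃ = 0` for every `X`. -/
theorem ent_R3 (X : UT) : (E 2 3 * X) 0 3 = 0 := by simp [E, Matrix.mul_apply]
/-- [folklore] `(E₀₁·E₂₃·X)₀₃ = 0`. -/
theorem ent_R4 (X : UT) : (E 0 1 * E 2 3 * X) 0 3 = 0 := by simp [E, Matrix.mul_apply]
/-- [folklore] `(E₁₂·E₂₃·X)₀₃ = 0`. -/
theorem ent_R5 (X : UT) : (E 1 2 * E 2 3 * X) 0 3 = 0 := by simp [E, Matrix.mul_apply]
/-- [folklore] `(E₁₂·E₀₁·X)₀₃ = 0`. -/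
theorem ent_R7 (X : UT) : (E 1 2 * E 0 1 * X) 0 3 = 0 := by simp [E, Matrix.mul_apply]
/-- [folklore] `(E₀₁·(E₁₂·E₂₃))₀₃ = 1`. -/
theorem ent_R6r : (E 0 1 * (E 1 2 * E 2 3)) 0 3 = 1 := by simp [E]
/-- [folklore] `(E₁₂·(E₀₁·E₂₃))₀₃ = 0`. -/
theorem ent_R7r : (E 1 2 * (E 0 1 * E 2 3)) 0 3 = 0 := by simp [E]
/-- [folklore] `(E₀₁·(E₂₃·E₁₂))₀₃ = 0`. -/
theorem ent_R4r : (E 0 1 * (E 2 3 * E 1 2)) 0 3 = 0 := by simp [E]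
/-- [folklore] `(E₁₂·(E₂₃·E₀₁))₀₃ = 0`. -/
theorem ent_R5r : (E 1 2 * (E 2 3 * E 0 1)) 0 3 = 0 := by simp [E]

end Entries

/-! ## §3 The root term: components of the pure-background averaging `Φ₀ = (PhiRAt ρ 0 B B′).fst` and the conjugation formula -/

section Root

omit [Algebra 𝕜 𝔸] in
/-- [folklore] The ordered chart letter in `Y`-form: `Ebg B B′ = Y(B′; B) + τ₁τ₂·[B, B′]`. -/
theorem Ebg_eq_Yf (B B' : Form1 d 𝔸) : Ebg B B' = fun κ x => Yf B' B κ x + mk 0 0 0 (bw B B' κ x) := by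
  funext κ x
  exact ext4 (by simp [Ebg, Yf]) (by simp [Ebg, Yf]) (by simp [Ebg, Yf]) (by simp [Ebg, Yf, bw, AveragingHessianKernels.comm])

omit [Algebra 𝕜 𝔸] in
/-- [folklore] … and its inverse: `Ebi B B′ = Ȳ(B′; B) − τ₁τ₂·[B, B′]`. -/
theorem Ebi_eq_Yb (B B' : Form1 d 𝔸) : Ebi B B' = fun κ x => Yb B' B κ x - mk 0 0 0 (bw B B' κ x) := by
  funext κ x
  exact ext4 (by simp [Ebi, Yb]) (by simp [Ebi, Yb]) (by simp [Ebi, Yb]) (by simp [Ebi, Yb, bw, AveragingHessianKernels.comm])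

/-- [folklore] The background part of node 12's fluctuation-free averaging is the averaging of the chart letters (33D `fst_GfL`). -/
theorem fst_PhiRAt_zero (ρ : Fin d → ℤ) (B B' : Form1 d 𝔸) (L : ℕ) (μ : Fin d) (y : Fin d → ℤ) :
    (PhiRAt 𝕜 ρ 0 B B' L μ y).fst = PhiGAt 𝕜 ρ (Ebg B B') (Ebi B B') L μ y := by
  rw [PhiRAt_eq_PhiLAt]
  unfold PhiLAt
  have key := map_PhiGAt (TrivSqZeroExt.fstHom 𝕜 (Tau 𝔸) (Tau 𝔸)) ρ (GfL 0 (Ebg B B')) (GbL 0 (Ebi B B')) L μ y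
  simp only [TrivSqZeroExt.fstHom_apply, fst_GfL, fst_GbL] at key
  exact key

/-- [folklore] `Φ₀ = Φ^ρ(Y(B′;B)) + τ₁τ₂·(c([B,B′]) + ℓ⁻¹ Σ_b loop_b([B,B′]))` (33M3a `PhiGAt_add_top`). -/
theorem fst_PhiRAt_zero_eq_Y (ρ : Fin d → ℤ) (B B' : Form1 d 𝔸) (L : ℕ) (μ : Fin d) (y : Fin d → ℤ) :
    (PhiRAt 𝕜 ρ 0 B B' L μ y).fst
      = PhiGAt 𝕜 ρ (Yf B' B) (Yb B' B) L μ y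
        + mk 0 0 0 ((segUp (bw B B') ((L : ℤ) • y + ρ) μ L).sum + ((L : 𝕜) ^ d)⁻¹ • ∑ b ∈ AffineAveraging.box d L, (loopCAt ρ (bw B B') L μ y b).sum) := by
  rw [fst_PhiRAt_zero, Ebg_eq_Yf, Ebi_eq_Yb]
  exact PhiGAt_add_top (fun κ x => by simp [Yf]) (fun κ x => by simp [Yb]) (bw B B') ρ L μ y

variable {L : ℕ} (hL : (L : 𝕜) ≠ 0) (h2 : (2 : 𝕜) ≠ 0)
include hL

omit hL in
/-- [folklore] `c00 Φ₀ = 1`. -/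
theorem c00_fst_PhiRAt_zero (ρ : Fin d → ℤ) (B B' : Form1 d 𝔸) (μ : Fin d) (y : Fin d → ℤ) : c00 (PhiRAt 𝕜 ρ 0 B B' L μ y).fst = 1 := by
  rw [fst_PhiRAt_zero]; exact c00_PhiGAt (fun κ x => AveragingThirdJet.c00_Ebg _ _ κ x) (fun κ x => AveragingThirdJet.c00_Ebi _ _ κ x) ρ L μ y

/-- [folklore] `c10 Φ₀ = ℓ⁻¹ • Z_B`. -/
theorem c10_fst_PhiRAt_zero (ρ : Fin d → ℤ) (B B' : Form1 d 𝔸) (μ : Fin d) (y : Fin d → ℤ) :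
    c10 (PhiRAt 𝕜 ρ 0 B B' L μ y).fst = ((L : 𝕜) ^ d)⁻¹ • linAvgAt ρ B L μ y := by
  rw [fst_PhiRAt_zero_eq_Y, AveragingThirdJet.Tau.c10_add, AveragingThirdJet.Tau.c10_mk, add_zero, c10_PhiGAt_Y hL]

/-- [folklore] `c01 Φ₀ = ℓ⁻¹ • Z_{B′}`. -/
theorem c01_fst_PhiRAt_zero (ρ : Fin d → ℤ) (B B' : Form1 d 𝔸) (μ : Fin d) (y : Fin d → ℤ) :
    c01 (PhiRAt 𝕜 ρ 0 B B' L μ y).fst = ((L : 𝕜) ^ d)⁻¹ • linAvgAt ρ B' L μ y := by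
  rw [fst_PhiRAt_zero_eq_Y, AveragingThirdJet.Tau.c01_add, AveragingThirdJet.Tau.c01_mk, add_zero, c01_PhiGAt_Y hL]

include h2 in
/-- [folklore] **`c11 Φ₀`**: the pure-background ordered-pair functional — `(2ℓ)⁻¹ • (hessUAt ρ B′ B + Z_{[B′,B]}) + ℓ⁻¹ • Z_{[B,B′]} + 2⁻¹ℓ⁻² • {Z_B, Z_{B′}}`
(33M3a `c11_logT_PhiGAt_Y`, `c11_eq_logT_add`). -/
theorem c11_fst_PhiRAt_zero (ρ : Fin d → ℤ) (B B' : Form1 d 𝔸) (μ : Fin d) (y : Fin d → ℤ) :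
    c11 (PhiRAt 𝕜 ρ 0 B B' L μ y).fst
      = ((2 : 𝕜) * (L : 𝕜) ^ d)⁻¹ • (hessUAt ρ B' B L μ y + linAvgAt ρ (bw B' B) L μ y)
        + ((L : 𝕜) ^ d)⁻¹ • linAvgAt ρ (bw B B') L μ y
        + ((2 : 𝕜) * (L : 𝕜) ^ (2 * d))⁻¹ • (linAvgAt ρ B L μ y * linAvgAt ρ B' L μ y + linAvgAt ρ B' L μ y * linAvgAt ρ B L μ y) := by
  have hℓ : ((L : 𝕜) ^ d) ≠ 0 := pow_ne_zero d hL
  have h00 : c00 (PhiGAt 𝕜 ρ (Yf B' B) (Yb B' B) L μ y) = 1 := c00_PhiGAt (fun κ x => by simp [Yf]) (fun κ x => by simp [Yb]) ρ L μ y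
  rw [fst_PhiRAt_zero_eq_Y, AveragingThirdJet.Tau.c11_add, AveragingThirdJet.Tau.c11_mk, inv_smul_sum_box_loopCAt ρ _ hL, add_sub_cancel,
    c11_eq_logT_add (𝕜 := 𝕜) _ h00, c11_logT_PhiGAt_Y ρ _ _ hL h2, c10_PhiGAt_Y hL, c01_PhiGAt_Y hL]
  simp only [smul_add, smul_mul_assoc, mul_smul_comm, smul_smul, pow_mul', sq]
  match_scalars <;> (field_simp; try ring)

omit hL in
/-- [folklore] **THE CONJUGATION FORMULA**: for a group-like `X = 1 + τ₁p + τ₂q + τ₁τ₂s` with inverse `P`,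
`c11 (X·ιD·P) = sD − Ds + D(pq + qp) − pDq − qDp`. -/
theorem c11_conj_ι (X P : Tau 𝔸) (hX : c00 X = 1) (hXP : X * P = 1) (D : 𝔸) :
    c11 (X * ι D * P)
      = c11 X * D - D * c11 X + (D * (c10 X * c01 X + c01 X * c10 X) - c10 X * D * c01 X - c01 X * D * c10 X) := by
  have h00 : c00 P = 1 := by
    have h := congrArg c00 hXP; rw [AveragingThirdJet.Tau.c00_mul, hX, one_mul, AveragingThirdJet.Tau.c00_one] at h; exact h
  have h10 : c10 P = -c10 X := by
    have h := congrArg c10 hXP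
    rw [AveragingThirdJet.Tau.c10_mul, hX, h00, one_mul, mul_one, AveragingThirdJet.Tau.c10_one] at h
    exact eq_neg_of_add_eq_zero_left h
  have h01 : c01 P = -c01 X := by
    have h := congrArg c01 hXP
    rw [AveragingThirdJet.Tau.c01_mul, hX, h00, one_mul, mul_one, AveragingThirdJet.Tau.c01_one] at h
    exact eq_neg_of_add_eq_zero_left h
  have h11 : c11 P = -c11 X + (c10 X * c01 X + c01 X * c10 X) := by
    have h := congrArg c11 hXP
    rw [AveragingThirdJet.Tau.c11_mul, hX, h00, h10, h01, one_mul, mul_one, AveragingThirdJet.Tau.c11_one, add_assoc] at h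
    rw [eq_neg_of_add_eq_zero_left h]; noncomm_ring
  simp only [AveragingThirdJet.Tau.c11_mul, AveragingThirdJet.Tau.c10_mul, AveragingThirdJet.Tau.c01_mul, AveragingThirdJet.Tau.c00_mul,
    AveragingThirdJet.Tau.c00_ι, AveragingThirdJet.Tau.c10_ι, AveragingThirdJet.Tau.c01_ι, AveragingThirdJet.Tau.c11_ι, hX, h00, h10, h01, h11]
  noncomm_ring

end Root

/-! ## §4 The site law of `vh2Tab` in its FIRST (fluctuation) slot, every site -/

section Tables

variable {d L : ℕ} (hL : (L : ℚ) ≠ 0)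
include hL

open Classical in
/-- [folklore] The entry `(0,3)` of the ROOT TERM at the letters (`D := δ_u E₂₃`, `B = single g E₀₁`, `B′ = single h E₁₂`), order `(B, B′)`:
`[u = r₊] · ((2ℓ)⁻¹·(−hessCountAt h g − [h = g]·linCountAt h) + ℓ⁻¹·[g = h]·linCountAt g + (2ℓ²)⁻¹·linCountAt g·linCountAt h)`. -/
theorem root_entry_gh (ρ : Fin d → ℤ) (μ : Fin d) (y u : Fin d → ℤ) (g h : Bond d) :
    c11 ((PhiRAt ℚ ρ 0 (single g (E 0 1)) (single h (E 1 2)) L μ y).fst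
          * ι (if (L : ℤ) • y + ρ + (L : ℤ) • unitVec μ = u then E 2 3 else 0)
          * (invT (PhiRAt ℚ ρ 0 (single g (E 0 1)) (single h (E 1 2)) L μ y)).fst) 0 3
      = (if (L : ℤ) • y + ρ + (L : ℤ) • unitVec μ = u then (1 : ℚ) else 0)
          * (((2 : ℚ) * (L : ℚ) ^ d)⁻¹ * (-(hessCountAt ρ L μ y h g : ℚ) - (if h = g then (linCountAt ρ L μ y h : ℚ) else 0))
              + ((L : ℚ) ^ d)⁻¹ * (if g = h then (linCountAt ρ L μ y g : ℚ) else 0)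
              + ((2 : ℚ) * (L : ℚ) ^ (2 * d))⁻¹ * ((linCountAt ρ L μ y g : ℚ) * (linCountAt ρ L μ y h : ℚ))) := by
  have hX : c00 (PhiRAt ℚ ρ 0 (single g (E 0 1)) (single h (E 1 2)) L μ y).fst = 1 := c00_fst_PhiRAt_zero ρ _ _ μ y
  have hXP := fst_PhiLAt_zero_mul_fst_invT (𝕜 := ℚ) (E := Ebg (single g (E 0 1)) (single h (E 1 2))) (Eb := Ebi (single g (E 0 1)) (single h (E 1 2)))
    (fun κ x => AveragingThirdJet.c00_Ebg _ _ κ x) (fun κ x => AveragingThirdJet.c00_Ebi _ _ κ x) ρ L μ y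
  rw [← PhiRAt_eq_PhiLAt] at hXP
  by_cases hu : (L : ℤ) • y + ρ + (L : ℤ) • unitVec μ = u
  · rw [if_pos hu, if_pos hu, one_mul, c11_conj_ι _ _ hX hXP, c11_fst_PhiRAt_zero hL two_ne_zero, c10_fst_PhiRAt_zero hL, c01_fst_PhiRAt_zero hL,
      hessUAt_single, bw_single, bw_single, linAvgAt_single, linAvgAt_single, linAvgAt_single, linAvgAt_single]
    simp only [← Int.cast_smul_eq_zsmul ℚ, smul_add, smul_ite, smul_zero, Matrix.add_mul, Matrix.mul_add,
      Matrix.smul_mul, Matrix.mul_smul, smul_smul, ite_mul, mul_ite, zero_mul, mul_zero, Matrix.mul_assoc,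
      Matrix.add_apply, Matrix.sub_apply, Matrix.smul_apply, ite_entry, ent_R1, ent_R2, ent_R3, ent_R6r, ent_R7r, ent_R4r, ent_R5r, smul_eq_mul, mul_one,
      mul_zero, mul_neg, add_zero, sub_zero, zero_add]
    by_cases hgh : g = h
    · subst hgh; simp only [if_true]; ring
    · have hhg : ¬ h = g := fun e => hgh e.symm
      simp only [hgh, hhg, if_false]; ring
  · rw [if_neg hu, if_neg hu, zero_mul, AveragingThirdJet.ι_zero, mul_zero, zero_mul, AveragingThirdJet.Tau.c11_zero]
    rfl

open Classical in
/-- [folklore] The entry `(0,3)` of the ROOT TERM at the letters, order `(B′, B)`: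
`[u = r₊] · ((2ℓ)⁻¹·(hessCountAt g h + [g = h]·linCountAt g) − ℓ⁻¹·[h = g]·linCountAt h + (2ℓ²)⁻¹·linCountAt g·linCountAt h)`. -/
theorem root_entry_hg (ρ : Fin d → ℤ) (μ : Fin d) (y u : Fin d → ℤ) (g h : Bond d) :
    c11 ((PhiRAt ℚ ρ 0 (single h (E 1 2)) (single g (E 0 1)) L μ y).fst
          * ι (if (L : ℤ) • y + ρ + (L : ℤ) • unitVec μ = u then E 2 3 else 0)
          * (invT (PhiRAt ℚ ρ 0 (single h (E 1 2)) (single g (E 0 1)) L μ y)).fst) 0 3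
      = (if (L : ℤ) • y + ρ + (L : ℤ) • unitVec μ = u then (1 : ℚ) else 0)
          * (((2 : ℚ) * (L : ℚ) ^ d)⁻¹ * ((hessCountAt ρ L μ y g h : ℚ) + (if g = h then (linCountAt ρ L μ y g : ℚ) else 0))
              - ((L : ℚ) ^ d)⁻¹ * (if h = g then (linCountAt ρ L μ y h : ℚ) else 0)
              + ((2 : ℚ) * (L : ℚ) ^ (2 * d))⁻¹ * ((linCountAt ρ L μ y g : ℚ) * (linCountAt ρ L μ y h : ℚ))) := by
  have hX : c00 (PhiRAt ℚ ρ 0 (single h (E 1 2)) (single g (E 0 1)) L μ y).fst = 1 := c00_fst_PhiRAt_zero ρ _ _ μ y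
  have hXP := fst_PhiLAt_zero_mul_fst_invT (𝕜 := ℚ) (E := Ebg (single h (E 1 2)) (single g (E 0 1))) (Eb := Ebi (single h (E 1 2)) (single g (E 0 1)))
    (fun κ x => AveragingThirdJet.c00_Ebg _ _ κ x) (fun κ x => AveragingThirdJet.c00_Ebi _ _ κ x) ρ L μ y
  rw [← PhiRAt_eq_PhiLAt] at hXP
  by_cases hu : (L : ℤ) • y + ρ + (L : ℤ) • unitVec μ = u
  · rw [if_pos hu, if_pos hu, one_mul, c11_conj_ι _ _ hX hXP, c11_fst_PhiRAt_zero hL two_ne_zero, c10_fst_PhiRAt_zero hL, c01_fst_PhiRAt_zero hL,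
      hessUAt_single, bw_single, bw_single, linAvgAt_single, linAvgAt_single, linAvgAt_single, linAvgAt_single]
    simp only [← Int.cast_smul_eq_zsmul ℚ, smul_add, smul_ite, smul_zero, Matrix.add_mul, Matrix.mul_add,
      Matrix.smul_mul, Matrix.mul_smul, smul_smul, ite_mul, mul_ite, zero_mul, mul_zero, Matrix.mul_assoc,
      Matrix.add_apply, Matrix.sub_apply, Matrix.smul_apply, ite_entry, ent_R1, ent_R2, ent_R3, ent_R6r, ent_R7r, ent_R4r, ent_R5r, smul_eq_mul, mul_one,
      mul_zero, mul_neg, add_zero, sub_zero, zero_add]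
    by_cases hgh : g = h
    · subst hgh; simp only [if_true]; ring
    · have hhg : ¬ h = g := fun e => hgh e.symm
      simp only [hgh, hhg, if_false]; ring
  · rw [if_neg hu, if_neg hu, zero_mul, AveragingThirdJet.ι_zero, mul_zero, zero_mul, AveragingThirdJet.Tau.c11_zero]
    rfl

omit hL in
/-- [folklore] `[(p ? a : 0), b] = p ? [a, b] : 0`. -/
theorem comm_ite_left (p : Prop) [Decidable p] (a b : UT) :
    AveragingHessianKernels.comm (if p then a else 0) b = if p then AveragingHessianKernels.comm a b else 0 := by
  split_ifs <;> simp [AveragingHessianKernels.comm]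

set_option maxHeartbeats 800000 in
open Classical in
/-- [folklore] **THE SITE LAW OF `vh2Tab` IN ITS FIRST (FLUCTUATION) SLOT** (ℚ, general `d`, any root `ρ`, `(L:ℚ) ≠ 0`; EVERY site `u`, including the far
end `r₊ = L·y + ρ + L·e_μ` of the coarse bond): with `ℓ = L^d`, `n = linCountAt`, `hess = hessCountAt`, `m = vhCountAt` (all rooted, unnormalised),
`Σ_κ (s((κ, u − e_κ); g, h) − s((κ, u); g, h)) = ℓ⁻²·[u = h₊]·m(h, g) − ℓ⁻¹·[g = h]·[u = g₊]·n(g) + [u = r₊]·(ℓ⁻¹·hess(g, h) + ℓ⁻²·n(g)·n(h))`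
— the second background `h` ROTATED AT ITS FAR END and paired with `g` by the first-order border count (`h` in the fluctuation slot), the diagonal double
rotation read by the linear count, and the ROOT contact (the pure-background ordered-pair count; `hessCountAt_swap`). -/
theorem vh2Tab_siteWard₀ (ρ : Fin d → ℤ) (μ : Fin d) (y u : Fin d → ℤ) (g h : Bond d) :
    ∑ κ : Fin d, (vh2Tab ρ L μ y (κ, u - unitVec κ) g h - vh2Tab ρ L μ y (κ, u) g h)
      = ((L : ℚ) ^ (2 * d))⁻¹ * (if h.2 + unitVec h.1 = u then (1 : ℚ) else 0) * (vhCountAt ρ L μ y h g : ℚ)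
        - ((L : ℚ) ^ d)⁻¹ * (if g = h ∧ g.2 + unitVec g.1 = u then (1 : ℚ) else 0) * (linCountAt ρ L μ y g : ℚ)
        + (if (L : ℤ) • y + ρ + (L : ℤ) • unitVec μ = u then (1 : ℚ) else 0)
            * (((L : ℚ) ^ d)⁻¹ * (hessCountAt ρ L μ y g h : ℚ) + ((L : ℚ) ^ (2 * d))⁻¹ * ((linCountAt ρ L μ y g : ℚ) * (linCountAt ρ L μ y h : ℚ))) := by
  have key := T2At_gauge_fluct (𝕜 := ℚ) (𝔸 := UT) (fun x' : Site d => if x' = u then E 2 3 else 0) hL two_ne_zero ρ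
    (single g (E 0 1)) (single h (E 1 2)) μ y
  simp only [grad_ite_eq_sum, upF_sum', upF_sub', T2At_sum_ω, T2At_sub_ω, gmode1_single_eq, gmode2o_single_single, vhUAt_single, linAvgAt_single,
    comm_ite_left] at key
  have k := congrFun (congrFun key 0) 3
  simp only [Matrix.sum_apply, Matrix.sub_apply, Matrix.add_apply, Matrix.smul_apply, ← Int.cast_smul_eq_zsmul ℚ, smul_ite, smul_zero, ite_entry,
    ent_Xc_ap, ent_B2, ent_X2_ap, ent_W4_ap, smul_eq_mul, mul_zero, mul_one, mul_neg, root_entry_gh hL, root_entry_hg hL] at k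
  have hs : ∀ f : Bond d, vh2Tab ρ L μ y f g h = T2At ℚ ρ (upF (single f (E 2 3))) (single g (E 0 1)) (single h (E 1 2)) L μ y 0 3 := fun f => rfl
  simp only [hs]
  rw [k, hessCountAt_swap ρ L μ y g h]
  push_cast
  by_cases hgh : g = h
  · subst hgh
    simp only [true_and, if_true]
    split_ifs <;> ring
  · have hhg : ¬ h = g := fun e => hgh e.symm
    simp only [hgh, hhg, false_and, if_false]
    split_ifs <;> ring

end Tables

end Summit.QuantumFields.BalabanUV.Beta.BorderWardSiteLawFluct
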